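import Literature.Probability.RandomPlanarGeometry.HammersleyWelshBound
import Literature.Probability.RandomPlanarGeometry.SAWReflect
import Mathlib.Analysis.SpecialFunctions.Exp

/-!
# Kesten's identity, part I: the span recurrence for half-space walks

Support file for item `stmt-CriticalPhenomena-4733` (`SAWRenewalTightness.KestenIdentity`), first
half of the finite form of Madras–Slade, Corollary 3.1.8 (the bridge generating function diverges
at `z_c`). Everything is in the vertex-function model `Zd.saws d n` / `Zd.halfSpaceWalks d n` /
`Zd.bridges d n` of `SAWCount.lean`, `SAWBridges.lean`, on `ℤ^d`, `d ≥ 1`: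

* `sum_range_sum_range_mul_le` — the finite Cauchy-product bound
  `Σ_{n ≤ M} Σ_{p ≤ n} a_p b_{n-p} ≤ (Σ_{p ≤ M} a_p)(Σ_{k ≤ M} b_k)` for non-negative reals, and the
  abstract generating-function steps `gf_le_gf_mul_one_add`, `le_exp_sum_of_succ_le`;
* the Hammersley–Welsh / Duminil-Copin–Smirnov span recurrence: an `n`-step half-space walk whose
  first coordinate has maximum `S + 1`, cut at the LAST visit `n₁` to the maximum, is an `n₁`-step
  bridge of span `S + 1` followed by (the reflection `Zd.reflAt 0 0` of) a half-space walk of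
  maximum `≤ S`, injectively: `card_filter_maxLevel_eq_le`, `card_filter_maxLevel_le_succ_le`
  (Madras–Slade, proof of Proposition 3.1.5, "`A₁ > A₂ > ⋯`"; the counting behind (3.1.12)).

The generating-function consequences (`H_M ≤ exp (B_M - 1)`, Corollary 3.1.8) are in
`SAWRenewalTightnessKestenIdentityBridgeGF.lean`.

References: N. Madras, G. Slade, *The Self-Avoiding Walk* (1993), §3.1, proof of Proposition 3.1.5
and of Corollary 3.1.8; H. Duminil-Copin, S. Smirnov, Ann. of Math. 175 (2012), §3 (the span
recurrence in this cut-at-the-last-maximum form).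
-/

noncomputable section

open Finset Literature.Probability.LatticeModels Literature.Probability.Percolation
open Literature.Probability.RandomPlanarGeometry.SAW.Zd
open scoped BigOperators

namespace Summit.CriticalPhenomena.SAWScalingLimit.Theorems.KestenIdentity

/-! ### A finite Cauchy-product bound -/

/-- `Σ_{n ≤ M} Σ_{p ≤ n} a_p b_{n-p} ≤ (Σ_{p ≤ M} a_p) · (Σ_{k ≤ M} b_k)` for non-negative reals: the
left side is the sum of `a_p b_k` over `p + k ≤ M`. [folklore] -/
theorem sum_range_sum_range_mul_le (a b : ℕ → ℝ) (ha : ∀ p, 0 ≤ a p) (hb : ∀ k, 0 ≤ b k) (M : ℕ) :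
    ∑ n ∈ range (M + 1), ∑ p ∈ range (n + 1), a p * b (n - p) ≤
      (∑ p ∈ range (M + 1), a p) * ∑ k ∈ range (M + 1), b k := by
  rw [Finset.sum_mul_sum, Finset.sum_sigma', ← Finset.sum_product']
  -- reindex `⟨n, p⟩ ↦ (p, n - p)`
  have hinj : Set.InjOn (fun q : (Σ _ : ℕ, ℕ) => (q.2, q.1 - q.2))
      ↑((range (M + 1)).sigma fun n => range (n + 1)) := by
    rintro ⟨n, p⟩ hq ⟨n', p'⟩ hq' h
    simp only [Finset.coe_sigma, Set.mem_sigma_iff, Finset.mem_coe, Finset.mem_range] at hq hq'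
    simp only [Prod.mk.injEq] at h
    obtain ⟨rfl, h2⟩ := h
    have : n = n' := by omega
    subst this
    rfl
  calc ∑ q ∈ (range (M + 1)).sigma (fun n => range (n + 1)), a q.2 * b (q.1 - q.2)
      = ∑ q ∈ (range (M + 1)).sigma (fun n => range (n + 1)),
          (fun r : ℕ × ℕ => a r.1 * b r.2) (q.2, q.1 - q.2) := rfl
    _ = ∑ r ∈ ((range (M + 1)).sigma (fun n => range (n + 1))).image
          (fun q : (Σ _ : ℕ, ℕ) => (q.2, q.1 - q.2)), a r.1 * b r.2 :=
        (Finset.sum_image (f := fun r : ℕ × ℕ => a r.1 * b r.2) hinj).symm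
    _ ≤ ∑ r ∈ range (M + 1) ×ˢ range (M + 1), a r.1 * b r.2 := by
        refine Finset.sum_le_sum_of_subset_of_nonneg ?_ fun r _ _ => mul_nonneg (ha _) (hb _)
        intro r hr
        simp only [Finset.mem_image, Finset.mem_sigma, Finset.mem_range] at hr
        obtain ⟨⟨n, p⟩, ⟨hn, hp⟩, rfl⟩ := hr
        simp only [Finset.mem_product, Finset.mem_range]
        dsimp only at hn hp ⊢
        omega

/-! ### Abstract generating-function bookkeeping -/

/-- If `h'_n ≤ h_n + Σ_{p ≤ n} β_p h_{n-p}` for all `n` (non-negative sequences), then the truncated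
generating functions satisfy `Σ_{n ≤ M} h'_n xⁿ ≤ (Σ_{n ≤ M} h_n xⁿ)(1 + Σ_{n ≤ M} β_n xⁿ)` for
`x ≥ 0`. [folklore] -/
theorem gf_le_gf_mul_one_add {h h' β : ℕ → ℝ} (hh : ∀ n, 0 ≤ h n) (hβ : ∀ n, 0 ≤ β n)
    (hrec : ∀ n, h' n ≤ h n + ∑ p ∈ range (n + 1), β p * h (n - p)) {x : ℝ} (hx : 0 ≤ x) (M : ℕ) :
    ∑ n ∈ range (M + 1), h' n * x ^ n ≤
      (∑ n ∈ range (M + 1), h n * x ^ n) * (1 + ∑ n ∈ range (M + 1), β n * x ^ n) := by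
  have key : ∀ n ∈ range (M + 1), h' n * x ^ n ≤
      h n * x ^ n + ∑ p ∈ range (n + 1), (β p * x ^ p) * (h (n - p) * x ^ (n - p)) := by
    intro n _
    have h2 : ∑ p ∈ range (n + 1), (β p * x ^ p) * (h (n - p) * x ^ (n - p)) =
        (∑ p ∈ range (n + 1), β p * h (n - p)) * x ^ n := by
      rw [Finset.sum_mul]
      refine Finset.sum_congr rfl fun p hp => ?_
      have : x ^ n = x ^ p * x ^ (n - p) := by
        rw [← pow_add, Nat.add_sub_cancel' (Nat.le_of_lt_succ (Finset.mem_range.1 hp))]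
      rw [this]; ring
    rw [h2, ← add_mul]
    exact mul_le_mul_of_nonneg_right (hrec n) (pow_nonneg hx n)
  calc ∑ n ∈ range (M + 1), h' n * x ^ n
      ≤ ∑ n ∈ range (M + 1),
          (h n * x ^ n + ∑ p ∈ range (n + 1), (β p * x ^ p) * (h (n - p) * x ^ (n - p))) :=
        Finset.sum_le_sum key
    _ = (∑ n ∈ range (M + 1), h n * x ^ n) +
          ∑ n ∈ range (M + 1), ∑ p ∈ range (n + 1), (β p * x ^ p) * (h (n - p) * x ^ (n - p)) :=
        Finset.sum_add_distrib
    _ ≤ (∑ n ∈ range (M + 1), h n * x ^ n) +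
          (∑ p ∈ range (M + 1), β p * x ^ p) * ∑ k ∈ range (M + 1), h k * x ^ k :=
        add_le_add le_rfl (sum_range_sum_range_mul_le (fun p => β p * x ^ p) (fun k => h k * x ^ k)
          (fun p => mul_nonneg (hβ p) (pow_nonneg hx p))
          (fun k => mul_nonneg (hh k) (pow_nonneg hx k)) M)
    _ = (∑ n ∈ range (M + 1), h n * x ^ n) * (1 + ∑ n ∈ range (M + 1), β n * x ^ n) := by ring

/-- If `H₀ ≤ 1` and `H_{S+1} ≤ H_S (1 + B_{S+1})` with `H, B ≥ 0`, then `H_S ≤ exp (Σ_{s < S} B_{s+1})`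
(`1 + t ≤ eᵗ`). [folklore] -/
theorem le_exp_sum_of_succ_le {H B : ℕ → ℝ} (hB : ∀ s, 0 ≤ B s) (h0 : H 0 ≤ 1)
    (hrec : ∀ S, H (S + 1) ≤ H S * (1 + B (S + 1))) (S : ℕ) :
    H S ≤ Real.exp (∑ s ∈ range S, B (s + 1)) := by
  induction S with
  | zero => simpa using h0
  | succ S ih =>
    calc H (S + 1) ≤ H S * (1 + B (S + 1)) := hrec S
      _ ≤ Real.exp (∑ s ∈ range S, B (s + 1)) * Real.exp (B (S + 1)) := by
          refine mul_le_mul ih ?_ (add_nonneg zero_le_one (hB _)) (Real.exp_nonneg _)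
          have := Real.add_one_le_exp (B (S + 1))
          linarith
      _ = Real.exp (∑ s ∈ range (S + 1), B (s + 1)) := by
          rw [Finset.sum_range_succ, Real.exp_add]

/-! ### The span recurrence for half-space walks (vertex-function model) -/

section Decomposition

variable {d : ℕ} [NeZero d]

omit [NeZero d] in
/-- The head piece `ω[0, p]`, frozen at `p`, of an `n`-step self-avoiding walk is a `p`-step
self-avoiding walk. [folklore] -/
theorem head_mem_saws {n p : ℕ} {ω : ℕ → Site d} (hω : ω ∈ saws d n) (hp : p ≤ n) :
    (fun i => ω (min i p)) ∈ saws d p := by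
  obtain ⟨h0, hend, hadj, hinj⟩ := mem_saws.1 hω
  refine mem_saws.2 ⟨by simpa using h0, fun i hi => by simp [min_eq_right hi], fun i hi => ?_, ?_⟩
  · have h1 : min i p = i := min_eq_left hi.le
    have h2 : min (i + 1) p = i + 1 := min_eq_left (by omega)
    simp only [h1, h2]
    exact hadj i (by omega)
  · intro i hi j hj hij
    simp only [Set.mem_setOf_eq] at hi hj
    simp only [min_eq_left hi, min_eq_left hj] at hij
    exact hinj (show i ∈ {i | i ≤ n} by simp only [Set.mem_setOf_eq]; omega)
      (show j ∈ {i | i ≤ n} by simp only [Set.mem_setOf_eq]; omega) hij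

/-- The head piece of a half-space walk, cut at a time `p` where the first coordinate is maximal,
is a `p`-step bridge ("the `n` first vertices of the walk form a bridge").
[cite: MadrasSlade1993, §3.1 (proof of Proposition 3.1.5)] -/
theorem head_mem_bridges {n p : ℕ} {ω : ℕ → Site d} (hω : ω ∈ halfSpaceWalks d n) (hp : p ≤ n)
    (hmax : ∀ i ≤ n, ω i 0 ≤ ω p 0) : (fun i => ω (min i p)) ∈ bridges d p := by
  obtain ⟨hs, hh⟩ := mem_halfSpaceWalks.1 hω
  refine mem_bridges.2 ⟨head_mem_saws hs hp, fun i h1 hi => ?_⟩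
  simp only [Nat.zero_min, min_eq_left hi, min_self]
  exact ⟨hh i h1 (hi.trans hp), hmax i (hi.trans hp)⟩

/-- First coordinate of the reflected, re-based tail piece. [folklore] -/
theorem reflAt_tail_apply_zero {n p : ℕ} (ω : ℕ → Site d) (i : ℕ) :
    reflAt 0 0 (ω (p + min i (n - p)) - ω p) 0 = ω p 0 - ω (p + min i (n - p)) 0 := by
  simp

/-- The tail piece `ω[p, n]`, reflected in the first coordinate and re-based at `0`, of an
`n`-step self-avoiding walk is an `(n - p)`-step self-avoiding walk. [folklore] -/
theorem tail_mem_saws {n p : ℕ} {ω : ℕ → Site d} (hω : ω ∈ saws d n) (hp : p ≤ n) :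
    (fun i => reflAt 0 0 (ω (p + min i (n - p)) - ω p)) ∈ saws d (n - p) := by
  obtain ⟨h0, hend, hadj, hinj⟩ := mem_saws.1 hω
  refine mem_saws.2 ⟨?_, ?_, ?_, ?_⟩
  · show reflAt 0 0 (ω (p + min 0 (n - p)) - ω p) = 0
    rw [Nat.zero_min, add_zero, sub_self]
    funext j
    by_cases hj : j = 0
    · subst hj; simp
    · simp [hj]
  · intro i hi
    simp only [min_eq_right hi, min_self]
  · intro i hi
    show (zdGraph d).Adj (reflAt 0 0 (ω (p + min i (n - p)) - ω p))
      (reflAt 0 0 (ω (p + min (i + 1) (n - p)) - ω p))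
    rw [zdGraph_adj_reflAt, zdGraph_adj_sub_right, min_eq_left hi.le,
      min_eq_left (by omega : i + 1 ≤ n - p), ← add_assoc]
    exact hadj (p + i) (by omega)
  · intro i hi j hj hij
    simp only [Set.mem_setOf_eq] at hi hj
    have h1 := reflAt_injective 0 0 hij
    rw [min_eq_left hi, min_eq_left hj, sub_left_inj] at h1
    have := hinj (show p + i ∈ {i | i ≤ n} by simp only [Set.mem_setOf_eq]; omega)
      (show p + j ∈ {i | i ≤ n} by simp only [Set.mem_setOf_eq]; omega) h1
    omega

/-- The reflected tail piece of a half-space walk with maximal first coordinate `S + 1`, cut at the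
LAST visit `p` to the maximum, is a half-space walk whose first coordinate stays `≤ S` ("the
consequent steps form a half-plane walk of width `T₁ < T₀`").
[cite: MadrasSlade1993, §3.1 (proof of Proposition 3.1.5)] -/
theorem tail_mem_filter {n p S : ℕ} {ω : ℕ → Site d} (hω : ω ∈ halfSpaceWalks d n) (hp : p ≤ n)
    (hlev : ω p 0 = (S : ℤ) + 1) (hlt : ∀ i, p < i → i ≤ n → ω i 0 < ω p 0) :
    (fun i => reflAt 0 0 (ω (p + min i (n - p)) - ω p)) ∈
      (halfSpaceWalks d (n - p)).filter fun ξ => maxLevel (n - p) ξ ≤ (S : ℤ) := by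
  obtain ⟨hs, hh⟩ := mem_halfSpaceWalks.1 hω
  have h0 := (mem_saws.1 hs).1
  have h00 : ω 0 0 = 0 := by rw [h0]; rfl
  have hp1 : 1 ≤ p := by
    rcases Nat.eq_zero_or_pos p with rfl | h
    · rw [h00] at hlev; omega
    · exact h
  refine Finset.mem_filter.2 ⟨mem_halfSpaceWalks.2 ⟨tail_mem_saws hs hp, fun i h1 hi => ?_⟩,
    maxLevel_le fun i hi => ?_⟩
  · dsimp only
    rw [reflAt_tail_apply_zero, reflAt_tail_apply_zero]
    rw [Nat.zero_min, add_zero, sub_self, min_eq_left hi, sub_pos]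
    exact hlt (p + i) (by omega) (by omega)
  · rw [reflAt_tail_apply_zero, min_eq_left hi, hlev]
    have := hh (p + i) (by omega) (by omega)
    rw [h00] at this
    linarith

/-- **The span recurrence, counting form.** The `n`-step half-space walks with maximal first
coordinate exactly `S + 1` inject into pairs (a `p`-step bridge of span `S + 1`, an `(n-p)`-step
half-space walk of maximum `≤ S`), `0 ≤ p ≤ n`: cut at the last visit to the maximum and reflect
the tail. [cite: MadrasSlade1993, §3.1 (proof of Proposition 3.1.5 and of Corollary 3.1.8)] -/
theorem card_filter_maxLevel_eq_le (n S : ℕ) :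
    ((halfSpaceWalks d n).filter fun ω => maxLevel n ω = (S : ℤ) + 1).card ≤
      ∑ p ∈ range (n + 1), ((bridges d p).filter fun ξ => ξ p 0 = (S : ℤ) + 1).card *
        ((halfSpaceWalks d (n - p)).filter fun ξ => maxLevel (n - p) ξ ≤ (S : ℤ)).card := by
  classical
  have hcard : ((range (n + 1)).sigma fun p =>
      ((bridges d p).filter fun ξ => ξ p 0 = (S : ℤ) + 1) ×ˢ
        ((halfSpaceWalks d (n - p)).filter fun ξ => maxLevel (n - p) ξ ≤ (S : ℤ))).card =
      ∑ p ∈ range (n + 1), ((bridges d p).filter fun ξ => ξ p 0 = (S : ℤ) + 1).card *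
        ((halfSpaceWalks d (n - p)).filter fun ξ => maxLevel (n - p) ξ ≤ (S : ℤ)).card := by
    rw [Finset.card_sigma]
    exact Finset.sum_congr rfl fun p _ => Finset.card_product _ _
  rw [← hcard]
  refine Finset.card_le_card_of_injOn
    (fun ω => (⟨lastArgmax n ω, (fun i => ω (min i (lastArgmax n ω)),
      fun i => reflAt 0 0 (ω (lastArgmax n ω + min i (n - lastArgmax n ω)) -
        ω (lastArgmax n ω)))⟩ : Σ _ : ℕ, (ℕ → Site d) × (ℕ → Site d))) ?_ ?_
  · intro ω hω
    rw [Finset.mem_coe, Finset.mem_filter] at hω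
    obtain ⟨hω, hM⟩ := hω
    obtain ⟨hp, hpM⟩ := lastArgmax_spec n ω
    rw [hM] at hpM
    rw [Finset.mem_coe, Finset.mem_sigma, Finset.mem_range, Finset.mem_product, Finset.mem_filter]
    refine ⟨Nat.lt_succ_of_le hp, ⟨head_mem_bridges hω hp fun i hi => ?_, ?_⟩,
      tail_mem_filter hω hp hpM fun i h1 h2 => ?_⟩
    · rw [hpM, ← hM]; exact apply_le_maxLevel ω hi
    · show ω (min (lastArgmax n ω) (lastArgmax n ω)) 0 = (S : ℤ) + 1
      rw [min_self, hpM]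
    · rw [hpM, ← hM]; exact apply_lt_maxLevel_of_lastArgmax_lt ω h1 h2
  · intro ω hω ω' hω' h
    rw [Finset.mem_coe, Finset.mem_filter] at hω hω'
    simp only [Sigma.mk.inj_iff] at h
    obtain ⟨hpp, h⟩ := h
    obtain ⟨h0, hend, -, -⟩ := mem_saws.1 (mem_halfSpaceWalks.1 hω.1).1
    obtain ⟨h0', hend', -, -⟩ := mem_saws.1 (mem_halfSpaceWalks.1 hω'.1).1
    set p := lastArgmax n ω with hpdef
    have hp : p ≤ n := (lastArgmax_spec n ω).1
    rw [← hpp] at h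
    have h' := eq_of_heq h
    simp only [Prod.mk.injEq] at h'
    obtain ⟨hh, ht⟩ := h'
    have hωp : ω p = ω' p := by simpa using congrFun hh p
    funext i
    rcases le_or_gt i p with hi | hi
    · simpa [min_eq_left hi] using congrFun hh i
    · rcases le_or_gt i n with hin | hin
      · have := congrFun ht (i - p)
        have h1 := reflAt_injective 0 0 this
        rw [min_eq_left (by omega : i - p ≤ n - p), show p + (i - p) = i by omega, hωp,
          sub_left_inj] at h1
        exact h1
      · have := congrFun ht (n - p)
        have h1 := reflAt_injective 0 0 this
        rw [min_self, show p + (n - p) = n by omega, hωp, sub_left_inj] at h1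
        rw [hend i hin.le, hend' i hin.le, h1]

/-- `H(n, ≤ S+1) ≤ H(n, ≤ S) + Σ_p (bridges of span S+1, length p)·(half-space walks of maximum ≤ S,
length n - p)`. [cite: MadrasSlade1993, §3.1 (proof of Corollary 3.1.8, eq. (3.1.12))] -/
theorem card_filter_maxLevel_le_succ_le (n S : ℕ) :
    ((halfSpaceWalks d n).filter fun ω => maxLevel n ω ≤ (S : ℤ) + 1).card ≤
      ((halfSpaceWalks d n).filter fun ω => maxLevel n ω ≤ (S : ℤ)).card +
      ∑ p ∈ range (n + 1), ((bridges d p).filter fun ξ => ξ p 0 = (S : ℤ) + 1).card *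
        ((halfSpaceWalks d (n - p)).filter fun ξ => maxLevel (n - p) ξ ≤ (S : ℤ)).card := by
  classical
  refine le_trans (Finset.card_le_card ?_)
    ((Finset.card_union_le _ _).trans (Nat.add_le_add_left (card_filter_maxLevel_eq_le n S) _))
  intro ω hω
  rw [Finset.mem_filter] at hω
  rw [Finset.mem_union, Finset.mem_filter, Finset.mem_filter]
  rcases lt_or_eq_of_le hω.2 with h | h
  · exact Or.inl ⟨hω.1, Int.lt_add_one_iff.1 h⟩
  · exact Or.inr ⟨hω.1, h⟩

end Decomposition

end Summit.CriticalPhenomena.SAWScalingLimit.Theorems.KestenIdentity
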